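import Summits.CriticalPhenomena.PercolationContinuityZ3.Theorems.Transplant.Slab111HubCheck2
import HarnessLib

/-!
# The HUB ROUTING of the `(111)`-films, XVII: coded dispatcher tables v3 — decoding, patterns, boxes, the cover checker `tab3OK`, soundness

builds on p205010 (kernel theorem, internal audit signed; external expert review pending) — NOT used in this file.  Lane `prim-bschramm`, seat
`prim-bschramm-p2` (gen 36; class C1b; memo `HOME/bschramm/P2-LATTICES.md` §130); helper file (`--supports stmt-CriticalPhenomena-4575 --as helper`).
Table language v3 of the gen-36 dispatcher.  A KEY is `(q₁, q₂, q₃, d₁, d₂, d₃)` (terminal columns relative to the hub, sides); a PATTERN adds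
the boundary flags `βᵢ ∈ {0,1,2}` (clamped distance of terminal `i` to the boundary behind it) and, for each same-side pair, the clamped level
difference `τ ∈ [−7, 7]`.  An entry (§1: `51`-bit code — three faces of `FACES`, three legs as base-7 words of `≤ 4` steps, digits `1–3`
zone-ward, `4–6` outward) ACCEPTS a pattern iff its legs accept the flags («Slab111HubCheck2».`accB`) and every same-side pair is valid
(`pairOKB`); the accepted set is a box, computed once per candidate as bit masks (§3 `boxOf`).  Realisable patterns satisfy the level RULES (§2: `pairRuleB`, `maybeB`; proved necessary in «Slab111HubTypes3») and a shape-specific flag filter.  **`tab3OK`** (§4) checks, for fixed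
`(q₁, q₂)`, every key against its candidate list (tables `A`: offset/count records, `C`: codes): some base-valid candidate's box contains every
rule-passing pattern.  **`tab3OK_sound`** (§5) extracts, for a given realisable pattern, an entry with `Entry.baseB`, the three acceptances and the
pair validities.
[cite: DuminilCopinSidoraviciusTassion2016, §2.3 (proof of Fact 2: the three disjoint paths γ_u, γ_v, γ_w in B_R(z))]
-/

namespace Summit.CriticalPhenomena.PercolationContinuityZ3.Theorems.Transplant

namespace Slab111

/-! ## §1 Decoding -/

/-- The up-step of a digit `w ∈ {1, 2, 3}`. [folklore] -/
def uOf (w : ℕ) : ℤ × ℤ := if w = 1 then (1, 0) else if w = 2 then (0, -1) else (-1, 1)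

/-- One leg step from `p` by digit `w`: `1–3` zone-ward (`+ dir·u_w`, level `+ dir`), `4–6` outward (`− dir·u_{w−3}`, level `− dir`). [folklore] -/
def stepMV3 (dir : ℤ) (p : MV) (w : ℕ) : MV :=
  if w ≤ 3 then ((p.1.1 + dir * (uOf w).1, p.1.2 + dir * (uOf w).2), p.2 + dir)
  else ((p.1.1 - dir * (uOf (w - 3)).1, p.1.2 - dir * (uOf (w - 3)).2), p.2 - dir)

/-- The leg of a `12`-bit code (base-7 digits, least significant first, `0` = stop, at most `4` steps). [folklore] -/
def legOf3 (dir : ℤ) (g : ℕ) : List MV :=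
  let o : MV := ((0, 0), 0)
  let p1 := stepMV3 dir o (g % 7)
  let p2 := stepMV3 dir p1 (g / 7 % 7)
  let p3 := stepMV3 dir p2 (g / 49 % 7)
  let p4 := stepMV3 dir p3 (g / 343 % 7)
  if g % 7 = 0 then [o] else if g / 7 % 7 = 0 then [o, p1] else if g / 49 % 7 = 0 then [o, p1, p2]
  else if g / 343 % 7 = 0 then [o, p1, p2, p3] else [o, p1, p2, p3, p4]

/-- **The 24 attachable faces of the radius-2 hexagon around the hub** (sorted by class) with their attachment direction. [folklore] -/
def FACES : List (FaceD × ℤ) :=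
  [(⟨(-2, 1), (-2, 0), (-1, 0)⟩, -1), (⟨(-1, -1), (-2, 0), (-1, 0)⟩, -1), (⟨(-2, 1), (-1, 1), (-2, 2)⟩, 1), (⟨(-2, 1), (-1, 1), (-1, 0)⟩, 1),
    (⟨(-2, 1), (-1, 1), (-1, 0)⟩, -1), (⟨(-1, 2), (-1, 1), (-2, 2)⟩, 1), (⟨(-1, -1), (0, -1), (-1, 0)⟩, 1), (⟨(-1, -1), (0, -1), (-1, 0)⟩, -1),
    (⟨(-1, -1), (0, -1), (0, -2)⟩, 1), (⟨(-1, 2), (-1, 1), (0, 1)⟩, 1), (⟨(-1, 2), (-1, 1), (0, 1)⟩, -1), (⟨(-1, 2), (0, 2), (0, 1)⟩, -1),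
    (⟨(1, -2), (0, -1), (0, -2)⟩, 1), (⟨(1, -2), (0, -1), (1, -1)⟩, 1), (⟨(1, -2), (0, -1), (1, -1)⟩, -1), (⟨(1, 1), (0, 2), (0, 1)⟩, -1),
    (⟨(1, 1), (1, 0), (0, 1)⟩, 1), (⟨(1, 1), (1, 0), (0, 1)⟩, -1), (⟨(1, -2), (2, -2), (1, -1)⟩, -1), (⟨(2, -1), (1, 0), (1, -1)⟩, 1),
    (⟨(2, -1), (1, 0), (1, -1)⟩, -1), (⟨(2, -1), (2, -2), (1, -1)⟩, -1), (⟨(1, 1), (1, 0), (2, 0)⟩, 1), (⟨(2, -1), (1, 0), (2, 0)⟩, 1)]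

/-- The face of a `5`-bit code. [folklore] -/
def faceOf (f : ℕ) : FaceD × ℤ := (FACES[f]?).getD (⟨(0, 0), (0, 0), (0, 0)⟩, 1)

/-- **The entry of a `51`-bit code** for the sides `d₁ d₂ d₃`. [folklore] -/
def entryOf3 (c : ℕ) (d₁ d₂ d₃ : ℤ) : Entry :=
  let f1 := faceOf (c % 32)
  let f2 := faceOf (c / 32 % 32)
  let f3 := faceOf (c / 1024 % 32)
  let g := c / 32768
  ⟨f1.1, f2.1, f3.1, f1.2, f2.2, f3.2, legOf3 d₁ (g % 4096), legOf3 d₂ (g / 4096 % 4096), legOf3 d₃ (g / 16777216 % 4096)⟩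

/-! ## §2 Patterns and the realisability rules -/

/-- The 15 clamped level differences. [folklore] -/
def TAUS : List ℤ := [-7, -6, -5, -4, -3, -2, -1, 0, 1, 2, 3, 4, 5, 6, 7]

/-- Clamping to `[−7, 7]`. [folklore] -/
def clampτ (x : ℤ) : ℤ := max (-7) (min 7 x)

/-- Lower end of the boundary-distance interval of a flag. [folklore] -/
def AloB (β : ℕ) : ℤ := if β = 0 then 0 else if β = 1 then 1 else 2
/-- Upper end of the boundary-distance interval of a flag (`100` = unbounded). [folklore] -/
def AhiB (β : ℕ) : ℤ := if β = 0 then 0 else if β = 1 then 1 else 100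
/-- Lower end of the unclamped differences of a `τ` (`−100` = unbounded). [folklore] -/
def uncLo (τ : ℤ) : ℤ := if τ = -7 then -100 else τ
/-- Upper end of the unclamped differences of a `τ`. [folklore] -/
def uncHi (τ : ℤ) : ℤ := if τ = 7 then 100 else τ

/-- **Pair rule**: the flags `βI, βJ` and `τ` of a same-side pair (side `d`) are jointly realisable by boundary distances — the interval of
`distJ − distI` allowed by the flags meets `d·(nJ − nI)` allowed by `τ` — and `τ ≠ 0` when the terminals share a column. [folklore] -/
def pairRuleB (βI βJ : ℕ) (τ d : ℤ) (samecol : Bool) : Bool :=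
  !(samecol && (τ == 0)) &&
    decide (max (AloB βJ - AhiB βI) (if d = 1 then uncLo τ else -uncHi τ) ≤ min (AhiB βJ - AloB βI) (if d = 1 then uncHi τ else -uncLo τ))

/-- **Triangle rule**: `τ13` is compatible with `τ12 + τ23` under clamping. [folklore] -/
def maybeB (τ12 τ13 τ23 : ℤ) : Bool :=
  decide (clampτ (uncLo τ12 + uncLo τ23) ≤ τ13) && decide (τ13 ≤ clampτ (uncHi τ12 + uncHi τ23))

/-! ## §3 Boxes -/

/-- **The box of an entry at a key**: the flag acceptances of the three legs (lists over `β = 0,1,2`; `badB d` = the columns missing from the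
cleared set on the boundary level behind side `d`) and the pair validities of the three pairs (lists over `TAUS`; all true when the pair is not
same-side). [folklore] -/
def boxOf (badB : ℤ → ℤ × ℤ → Bool) (e : Entry) (q₁ q₂ q₃ : ℤ × ℤ) (d₁ d₂ d₃ : ℤ) :
    List Bool × List Bool × List Bool × List Bool × List Bool × List Bool :=
  ((List.range 3).map fun β => accB e.l₁ q₁ d₁ β (badB d₁), (List.range 3).map fun β => accB e.l₂ q₂ d₂ β (badB d₂),
    (List.range 3).map fun β => accB e.l₃ q₃ d₃ β (badB d₃),
    TAUS.map fun τ => !(d₁ == d₂) || pairOKB e.l₁ e.l₂ q₁ q₂ e.F1 e.F2 d₁ τ,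
    TAUS.map fun τ => !(d₁ == d₃) || pairOKB e.l₁ e.l₃ q₁ q₃ e.F1 e.F3 d₁ τ,
    TAUS.map fun τ => !(d₂ == d₃) || pairOKB e.l₂ e.l₃ q₂ q₃ e.F2 e.F3 d₂ τ)

/-- A FULL box (accepts every flag and every `τ`). [folklore] -/
def fullBox (b : List Bool × List Bool × List Bool × List Bool × List Bool × List Bool) : Bool :=
  b.1.all id && b.2.1.all id && b.2.2.1.all id && b.2.2.2.1.all id && b.2.2.2.2.1.all id && b.2.2.2.2.2.all id

/-- A box contains a pattern. [folklore] -/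
def inBox (b : List Bool × List Bool × List Bool × List Bool × List Bool × List Bool) (β₁ β₂ β₃ : ℕ) (τ12 τ13 τ23 : ℤ) : Bool :=
  b.1.getD β₁ false && b.2.1.getD β₂ false && b.2.2.1.getD β₃ false &&
    b.2.2.2.1.getD (τ12 + 7).toNat false && b.2.2.2.2.1.getD (τ13 + 7).toNat false && b.2.2.2.2.2.getD (τ23 + 7).toNat false

/-! ## §4 Tables and the cover checker -/

/-- The record of `(q₃-index, side index)` in `A`: `20` bits, offset `14` + count `6`. [folklore] -/
def recA3 (A : ℕ) (i₃ idir : ℕ) : ℕ × ℕ := let r := A / 2 ^ (20 * (8 * i₃ + idir)) % 2 ^ 20; (r / 64, r % 64)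

/-- The candidate codes of a key: `count` consecutive `51`-bit codes of `C` from `offset`. [folklore] -/
def candsOf (A C : ℕ) (i₃ idir : ℕ) : List ℕ :=
  let r := recA3 A i₃ idir
  (List.range r.2).map fun j => C / 2 ^ (51 * (r.1 + j)) % 2 ^ 51

/-- The sides of an index. [folklore] -/
def dirsOf (idir : ℕ) : ℤ × ℤ × ℤ := (if idir / 4 % 2 = 0 then 1 else -1, if idir / 2 % 2 = 0 then 1 else -1, if idir % 2 = 0 then 1 else -1)

/-- The index of a side triple. [folklore] -/
def idirOf (d₁ d₂ d₃ : ℤ) : ℕ := (if d₁ = 1 then 0 else 4) + (if d₂ = 1 then 0 else 2) + (if d₃ = 1 then 0 else 1)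

/-- **COVER CHECK OF ONE KEY**: every pattern passing the shape's flag filter `filt` (what `Terminals` and the cleared set allow) and the
level rules lies in the box of some base-valid candidate. [folklore] -/
def keyCoverB (pcB wcB : ℤ × ℤ → Bool) (badB : ℤ → ℤ × ℤ → Bool) (filt : ℕ → ℕ → ℕ → Bool) (q₁ q₂ q₃ : ℤ × ℤ) (d₁ d₂ d₃ : ℤ)
    (cands : List ℕ) : Bool :=
  let boxes := (cands.map fun c => entryOf3 c d₁ d₂ d₃).filterMap fun e =>
    if e.baseB pcB wcB q₁ q₂ q₃ d₁ d₂ d₃ 3 then some (boxOf badB e q₁ q₂ q₃ d₁ d₂ d₃) else none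
  let s12 := q₁ == q₂
  let s13 := q₁ == q₃
  let s23 := q₂ == q₃
  boxes.any fullBox ||
  (List.range 3).all fun β₁ => (List.range 3).all fun β₂ => (List.range 3).all fun β₃ => !filt β₁ β₂ β₃ ||
      if d₁ = d₂ ∧ d₁ = d₃ then
        TAUS.all fun τ12 => !pairRuleB β₁ β₂ τ12 d₁ s12 || TAUS.all fun τ23 => !pairRuleB β₂ β₃ τ23 d₁ s23 ||
          TAUS.all fun τ13 => !pairRuleB β₁ β₃ τ13 d₁ s13 || !maybeB τ12 τ13 τ23 || boxes.any fun b => inBox b β₁ β₂ β₃ τ12 τ13 τ23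
      else if d₁ = d₂ then TAUS.all fun τ => !pairRuleB β₁ β₂ τ d₁ s12 || boxes.any fun b => inBox b β₁ β₂ β₃ τ 0 0
      else if d₁ = d₃ then TAUS.all fun τ => !pairRuleB β₁ β₃ τ d₁ s13 || boxes.any fun b => inBox b β₁ β₂ β₃ 0 τ 0
      else TAUS.all fun τ => !pairRuleB β₂ β₃ τ d₂ s23 || boxes.any fun b => inBox b β₁ β₂ β₃ 0 0 τ

/-- **THE TABLE CHECKER v3** for fixed `(q₁, q₂)` and a shape (region predicates `pcB, wcB`, boundary-missing columns `badB`, flag filter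
`filtOf`): every `q₃ ∈ cols ∖ {hub, q₁, q₂}` and every side triple pass `keyCoverB` with the candidates of `(A, C)`. [folklore] -/
def tab3OK (pcB wcB : ℤ × ℤ → Bool) (badB : ℤ → ℤ × ℤ → Bool) (filtOf : ℤ × ℤ → ℤ × ℤ → ℤ × ℤ → ℤ → ℤ → ℤ → ℕ → ℕ → ℕ → Bool)
    (cols : List (ℤ × ℤ)) (q₁ q₂ : ℤ × ℤ) (A C : ℕ) : Bool :=
  (List.range cols.length).all fun i₃ =>
    let q₃ := (cols[i₃]?).getD (0, 0)
    q₃ == (0, 0) || q₃ == q₁ || q₃ == q₂ ||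
      (List.range 8).all fun idir =>
        let d := dirsOf idir
        keyCoverB pcB wcB badB (filtOf q₁ q₂ q₃ d.1 d.2.1 d.2.2) q₁ q₂ q₃ d.1 d.2.1 d.2.2 (candsOf A C i₃ idir)

/-! ## §5 Soundness -/

/-- Reading a mapped `range` list. [folklore] -/
theorem getD_map_range {n : ℕ} {f : ℕ → Bool} {i : ℕ} (h : ((List.range n).map f).getD i false = true) : f i = true := by
  rw [List.getD_eq_getElem?_getD, List.getElem?_map] at h
  cases hi : (List.range n)[i]? with
  | none => rw [hi] at h; simp at h
  | some j =>
    rw [hi] at h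
    have := List.getElem?_range (by simpa using (List.getElem?_eq_some_iff.1 hi).1) ▸ hi
    simp only [Option.some.injEq] at this
    simpa [this] using h

/-- Reading a mapped `TAUS` list at `(τ + 7).toNat` for `τ ∈ [−7, 7]`. [folklore] -/
theorem getD_map_TAUS {f : ℤ → Bool} {τ : ℤ} (h7 : -7 ≤ τ) (h7' : τ ≤ 7) (h : (TAUS.map f).getD (τ + 7).toNat false = true) : f τ = true := by
  have hT : TAUS = (List.range 15).map fun i : ℕ => (i : ℤ) - 7 := by decide
  rw [hT, List.map_map] at h
  have := getD_map_range h
  simp only [Function.comp] at this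
  have e : (((τ + 7).toNat : ℕ) : ℤ) - 7 = τ := by omega
  rwa [e] at this

/-- Reading `List.all` over `range`. [folklore] -/
theorem all_range_get {n : ℕ} {f : ℕ → Bool} (h : (List.range n).all f = true) {i : ℕ} (hi : i < n) : f i = true := by
  rw [List.all_eq_true] at h; exact h i (List.mem_range.2 hi)

/-- Reading `List.all` over `TAUS`. [folklore] -/
theorem all_TAUS_get {f : ℤ → Bool} (h : TAUS.all f = true) {τ : ℤ} (hτ : τ ∈ TAUS) : f τ = true := by
  rw [List.all_eq_true] at h; exact h τ hτ

/-- Members of `TAUS` are in `[−7, 7]`. [folklore] -/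
theorem TAUS_bounds {τ : ℤ} (h : τ ∈ TAUS) : -7 ≤ τ ∧ τ ≤ 7 := by
  simp only [TAUS, List.mem_cons, List.not_mem_nil, or_false] at h; omega

/-- An implication guard. [folklore] -/
theorem of_guardB {g b : Bool} (h : (!g || b) = true) (hg : g = true) : b = true := by
  rw [hg] at h; simpa using h

/-- A double implication guard (left-associated `||`). [folklore] -/
theorem of_guardB2 {a b c : Bool} (h : ((!a || !b) || c) = true) (ha : a = true) (hb : b = true) : c = true := by
  rw [ha, hb] at h; simpa using h

/-- `dirsOf (idirOf d) = d` and the index is `< 8`. [folklore] -/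
theorem dirsOf_idirOf {d₁ d₂ d₃ : ℤ} (h₁ : d₁ = 1 ∨ d₁ = -1) (h₂ : d₂ = 1 ∨ d₂ = -1) (h₃ : d₃ = 1 ∨ d₃ = -1) :
    dirsOf (idirOf d₁ d₂ d₃) = (d₁, d₂, d₃) ∧ idirOf d₁ d₂ d₃ < 8 := by
  unfold dirsOf idirOf
  rcases h₁ with rfl | rfl <;> rcases h₂ with rfl | rfl <;> rcases h₃ with rfl | rfl <;> decide

/-- What a box membership yields. [folklore] -/
theorem inBox_sound {badB : ℤ → ℤ × ℤ → Bool} {e : Entry} {q₁ q₂ q₃ : ℤ × ℤ} {d₁ d₂ d₃ : ℤ} {β₁ β₂ β₃ : ℕ} {τ12 τ13 τ23 : ℤ}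
    (h : inBox (boxOf badB e q₁ q₂ q₃ d₁ d₂ d₃) β₁ β₂ β₃ τ12 τ13 τ23 = true) (hτ12 : τ12 ∈ TAUS) (hτ13 : τ13 ∈ TAUS) (hτ23 : τ23 ∈ TAUS) :
    accB e.l₁ q₁ d₁ β₁ (badB d₁) = true ∧ accB e.l₂ q₂ d₂ β₂ (badB d₂) = true ∧ accB e.l₃ q₃ d₃ β₃ (badB d₃) = true ∧
      (d₁ = d₂ → pairOKB e.l₁ e.l₂ q₁ q₂ e.F1 e.F2 d₁ τ12 = true) ∧ (d₁ = d₃ → pairOKB e.l₁ e.l₃ q₁ q₃ e.F1 e.F3 d₁ τ13 = true) ∧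
      (d₂ = d₃ → pairOKB e.l₂ e.l₃ q₂ q₃ e.F2 e.F3 d₂ τ23 = true) := by
  unfold inBox boxOf at h
  simp only [Bool.and_eq_true] at h
  obtain ⟨⟨⟨⟨⟨a1, a2⟩, a3⟩, t12⟩, t13⟩, t23⟩ := h
  obtain ⟨l12, u12⟩ := TAUS_bounds hτ12; obtain ⟨l13, u13⟩ := TAUS_bounds hτ13; obtain ⟨l23, u23⟩ := TAUS_bounds hτ23
  refine ⟨getD_map_range a1, getD_map_range a2, getD_map_range a3, fun hd => ?_, fun hd => ?_, fun hd => ?_⟩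
  · have := getD_map_TAUS l12 u12 t12; exact of_guardB this (by simp [hd])
  · have := getD_map_TAUS l13 u13 t13; exact of_guardB this (by simp [hd])
  · have := getD_map_TAUS l23 u23 t23; exact of_guardB this (by simp [hd])

/-- What `boxes.any` yields: a base-valid candidate entry whose box contains the pattern. [folklore] -/
theorem any_boxes_sound {pcB wcB : ℤ × ℤ → Bool} {badB : ℤ → ℤ × ℤ → Bool} {q₁ q₂ q₃ : ℤ × ℤ} {d₁ d₂ d₃ : ℤ} {cands : List ℕ}
    {β₁ β₂ β₃ : ℕ} {τ12 τ13 τ23 : ℤ}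
    (h : (((cands.map fun c => entryOf3 c d₁ d₂ d₃).filterMap fun e =>
      if e.baseB pcB wcB q₁ q₂ q₃ d₁ d₂ d₃ 3 then some (boxOf badB e q₁ q₂ q₃ d₁ d₂ d₃) else none).any
        fun b => inBox b β₁ β₂ β₃ τ12 τ13 τ23) = true) :
    ∃ e : Entry, e.baseB pcB wcB q₁ q₂ q₃ d₁ d₂ d₃ 3 = true ∧ inBox (boxOf badB e q₁ q₂ q₃ d₁ d₂ d₃) β₁ β₂ β₃ τ12 τ13 τ23 = true := by
  rw [List.any_eq_true] at h
  obtain ⟨b, hb, hin⟩ := h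
  rw [List.mem_filterMap] at hb
  obtain ⟨e, -, he⟩ := hb
  by_cases hbase : e.baseB pcB wcB q₁ q₂ q₃ d₁ d₂ d₃ 3 = true
  · rw [if_pos hbase] at he
    exact ⟨e, hbase, by rw [← Option.some.inj he] at hin; exact hin⟩
  · rw [if_neg hbase] at he; exact absurd he (by simp)

/-- **SOUNDNESS OF THE COVER CHECK OF ONE KEY.** [folklore] -/
theorem keyCoverB_sound {pcB wcB : ℤ × ℤ → Bool} {badB : ℤ → ℤ × ℤ → Bool} {filt : ℕ → ℕ → ℕ → Bool} {q₁ q₂ q₃ : ℤ × ℤ} {d₁ d₂ d₃ : ℤ}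
    {cands : List ℕ} (h : keyCoverB pcB wcB badB filt q₁ q₂ q₃ d₁ d₂ d₃ cands = true)
    (hd₁ : d₁ = 1 ∨ d₁ = -1) (hd₂ : d₂ = 1 ∨ d₂ = -1) (hd₃ : d₃ = 1 ∨ d₃ = -1)
    {β₁ β₂ β₃ : ℕ} (hb₁ : β₁ < 3) (hb₂ : β₂ < 3) (hb₃ : β₃ < 3) (hfilt : filt β₁ β₂ β₃ = true)
    {τ12 τ13 τ23 : ℤ} (hτ12 : τ12 ∈ TAUS) (hτ13 : τ13 ∈ TAUS) (hτ23 : τ23 ∈ TAUS)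
    (r12 : d₁ = d₂ → pairRuleB β₁ β₂ τ12 d₁ (q₁ == q₂) = true) (r13 : d₁ = d₃ → pairRuleB β₁ β₃ τ13 d₁ (q₁ == q₃) = true)
    (r23 : d₂ = d₃ → pairRuleB β₂ β₃ τ23 d₂ (q₂ == q₃) = true) (rtri : d₁ = d₂ → d₁ = d₃ → maybeB τ12 τ13 τ23 = true) :
    ∃ e : Entry, e.baseB pcB wcB q₁ q₂ q₃ d₁ d₂ d₃ 3 = true ∧
      accB e.l₁ q₁ d₁ β₁ (badB d₁) = true ∧ accB e.l₂ q₂ d₂ β₂ (badB d₂) = true ∧ accB e.l₃ q₃ d₃ β₃ (badB d₃) = true ∧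
      (d₁ = d₂ → pairOKB e.l₁ e.l₂ q₁ q₂ e.F1 e.F2 d₁ τ12 = true) ∧ (d₁ = d₃ → pairOKB e.l₁ e.l₃ q₁ q₃ e.F1 e.F3 d₁ τ13 = true) ∧
      (d₂ = d₃ → pairOKB e.l₂ e.l₃ q₂ q₃ e.F2 e.F3 d₂ τ23 = true) := by
  unfold keyCoverB at h
  dsimp only at h
  rw [Bool.or_eq_true] at h
  -- a helper turning a found box into the conclusion (used by the shortcut and by the loops)
  have finish0 : ∀ {t12 t13 t23 : ℤ}, t12 ∈ TAUS → t13 ∈ TAUS → t23 ∈ TAUS → (d₁ = d₂ → t12 = τ12) → (d₁ = d₃ → t13 = τ13) →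
      (d₂ = d₃ → t23 = τ23) → ∀ e : Entry, e.baseB pcB wcB q₁ q₂ q₃ d₁ d₂ d₃ 3 = true →
      inBox (boxOf badB e q₁ q₂ q₃ d₁ d₂ d₃) β₁ β₂ β₃ t12 t13 t23 = true →
      ∃ e : Entry, e.baseB pcB wcB q₁ q₂ q₃ d₁ d₂ d₃ 3 = true ∧
        accB e.l₁ q₁ d₁ β₁ (badB d₁) = true ∧ accB e.l₂ q₂ d₂ β₂ (badB d₂) = true ∧ accB e.l₃ q₃ d₃ β₃ (badB d₃) = true ∧
        (d₁ = d₂ → pairOKB e.l₁ e.l₂ q₁ q₂ e.F1 e.F2 d₁ τ12 = true) ∧ (d₁ = d₃ → pairOKB e.l₁ e.l₃ q₁ q₃ e.F1 e.F3 d₁ τ13 = true) ∧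
        (d₂ = d₃ → pairOKB e.l₂ e.l₃ q₂ q₃ e.F2 e.F3 d₂ τ23 = true) := by
    intro t12 t13 t23 m12 m13 m23 e12 e13 e23 e hbase hin
    obtain ⟨a1, a2, a3, p12, p13, p23⟩ := inBox_sound hin m12 m13 m23
    exact ⟨e, hbase, a1, a2, a3, fun hd => e12 hd ▸ p12 hd, fun hd => e13 hd ▸ p13 hd, fun hd => e23 hd ▸ p23 hd⟩
  rcases h with hfull | h
  · -- a candidate with a FULL box accepts the given pattern
    rw [List.any_eq_true] at hfull
    obtain ⟨b, hb, hfb⟩ := hfull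
    rw [List.mem_filterMap] at hb
    obtain ⟨e, -, he⟩ := hb
    by_cases hbase : e.baseB pcB wcB q₁ q₂ q₃ d₁ d₂ d₃ 3 = true
    · rw [if_pos hbase] at he
      have hbe : b = boxOf badB e q₁ q₂ q₃ d₁ d₂ d₃ := (Option.some.inj he).symm
      refine finish0 hτ12 hτ13 hτ23 (fun _ => rfl) (fun _ => rfl) (fun _ => rfl) e hbase ?_
      rw [← hbe]
      obtain ⟨l12, u12⟩ := TAUS_bounds hτ12; obtain ⟨l13, u13⟩ := TAUS_bounds hτ13; obtain ⟨l23, u23⟩ := TAUS_bounds hτ23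
      have hlen : b.1.length = 3 ∧ b.2.1.length = 3 ∧ b.2.2.1.length = 3 ∧ b.2.2.2.1.length = 15 ∧ b.2.2.2.2.1.length = 15 ∧
          b.2.2.2.2.2.length = 15 := by
        rw [hbe]; unfold boxOf; simp [TAUS]
      unfold fullBox at hfb
      simp only [Bool.and_eq_true, List.all_eq_true, id] at hfb
      obtain ⟨⟨⟨⟨⟨f1, f2⟩, f3⟩, f4⟩, f5⟩, f6⟩ := hfb
      have get : ∀ {l : List Bool} {i : ℕ}, (∀ x ∈ l, x = true) → i < l.length → l.getD i false = true := by
        intro l i hl hi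
        rw [List.getD_eq_getElem?_getD, List.getElem?_eq_getElem hi, Option.getD_some]
        exact hl _ (List.getElem_mem hi)
      unfold inBox
      simp only [Bool.and_eq_true]
      exact ⟨⟨⟨⟨⟨get f1 (by omega), get f2 (by omega)⟩, get f3 (by omega)⟩, get f4 (by omega)⟩, get f5 (by omega)⟩, get f6 (by omega)⟩
    · rw [if_neg hbase] at he; exact absurd he (by simp)
  -- peel the flag loops and the filter guard
  have g1 := all_range_get h hb₁
  have g2 := all_range_get g1 hb₂
  have g3 := of_guardB (all_range_get g2 hb₃) hfilt
  -- a helper turning a found box into the conclusion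
  have finish : ∀ {t12 t13 t23 : ℤ}, t12 ∈ TAUS → t13 ∈ TAUS → t23 ∈ TAUS → (d₁ = d₂ → t12 = τ12) → (d₁ = d₃ → t13 = τ13) →
      (d₂ = d₃ → t23 = τ23) →
      (((cands.map fun c => entryOf3 c d₁ d₂ d₃).filterMap fun e =>
        if e.baseB pcB wcB q₁ q₂ q₃ d₁ d₂ d₃ 3 then some (boxOf badB e q₁ q₂ q₃ d₁ d₂ d₃) else none).any
          fun b => inBox b β₁ β₂ β₃ t12 t13 t23) = true →
      ∃ e : Entry, e.baseB pcB wcB q₁ q₂ q₃ d₁ d₂ d₃ 3 = true ∧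
        accB e.l₁ q₁ d₁ β₁ (badB d₁) = true ∧ accB e.l₂ q₂ d₂ β₂ (badB d₂) = true ∧ accB e.l₃ q₃ d₃ β₃ (badB d₃) = true ∧
        (d₁ = d₂ → pairOKB e.l₁ e.l₂ q₁ q₂ e.F1 e.F2 d₁ τ12 = true) ∧ (d₁ = d₃ → pairOKB e.l₁ e.l₃ q₁ q₃ e.F1 e.F3 d₁ τ13 = true) ∧
        (d₂ = d₃ → pairOKB e.l₂ e.l₃ q₂ q₃ e.F2 e.F3 d₂ τ23 = true) := by
    intro t12 t13 t23 m12 m13 m23 e12 e13 e23 hany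
    obtain ⟨e, hbase, hin⟩ := any_boxes_sound hany
    obtain ⟨a1, a2, a3, p12, p13, p23⟩ := inBox_sound hin m12 m13 m23
    exact ⟨e, hbase, a1, a2, a3, fun hd => e12 hd ▸ p12 hd, fun hd => e13 hd ▸ p13 hd, fun hd => e23 hd ▸ p23 hd⟩
  have z : (0 : ℤ) ∈ TAUS := by decide
  by_cases hall : d₁ = d₂ ∧ d₁ = d₃
  · rw [if_pos hall] at g3
    have h23d : d₂ = d₃ := hall.1.symm.trans hall.2
    have a := of_guardB (all_TAUS_get g3 hτ12) (r12 hall.1)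
    have b := of_guardB (all_TAUS_get a hτ23) (by rw [hall.1]; exact r23 h23d)
    have c := of_guardB2 (all_TAUS_get b hτ13) (r13 hall.2) (rtri hall.1 hall.2)
    exact finish hτ12 hτ13 hτ23 (fun _ => rfl) (fun _ => rfl) (fun _ => rfl) c
  · rw [if_neg hall] at g3
    by_cases h12 : d₁ = d₂
    · rw [if_pos h12] at g3
      have h13 : d₁ ≠ d₃ := fun e => hall ⟨h12, e⟩
      have h23 : d₂ ≠ d₃ := fun e => h13 (h12.trans e)
      have a := of_guardB (all_TAUS_get g3 hτ12) (r12 h12)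
      exact finish hτ12 z z (fun _ => rfl) (fun e => absurd e h13) (fun e => absurd e h23) a
    · rw [if_neg h12] at g3
      by_cases h13 : d₁ = d₃
      · rw [if_pos h13] at g3
        have h23 : d₂ ≠ d₃ := fun e => h12 (h13.trans e.symm)
        have a := of_guardB (all_TAUS_get g3 hτ13) (r13 h13)
        exact finish z hτ13 z (fun e => absurd e h12) (fun _ => rfl) (fun e => absurd e h23) a
      · rw [if_neg h13] at g3
        have h23 : d₂ = d₃ := by
          rcases hd₁ with e1 | e1 <;> rcases hd₂ with e2 | e2 <;> rcases hd₃ with e3 | e3 <;> subst e1 <;> subst e2 <;> subst e3 <;>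
            simp_all
        have a := of_guardB (all_TAUS_get g3 hτ23) (r23 h23)
        exact finish z z hτ23 (fun e => absurd e h12) (fun e => absurd e h13) (fun _ => rfl) a

/-- A member of a list is at some index below the length. [folklore] -/
theorem exists_index_of_mem {cols : List (ℤ × ℤ)} {q : ℤ × ℤ} (h : q ∈ cols) : ∃ i < cols.length, (cols[i]?).getD (0, 0) = q := by
  obtain ⟨i, hi, e⟩ := List.getElem_of_mem h
  exact ⟨i, hi, by rw [List.getElem?_eq_getElem hi, Option.getD_some, e]⟩

/-- **SOUNDNESS OF THE TABLE CHECKER v3.** [folklore] -/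
theorem tab3OK_sound {pcB wcB : ℤ × ℤ → Bool} {badB : ℤ → ℤ × ℤ → Bool}
    {filtOf : ℤ × ℤ → ℤ × ℤ → ℤ × ℤ → ℤ → ℤ → ℤ → ℕ → ℕ → ℕ → Bool} {cols : List (ℤ × ℤ)} {q₁ q₂ : ℤ × ℤ} {A C : ℕ}
    (h : tab3OK pcB wcB badB filtOf cols q₁ q₂ A C = true)
    {q₃ : ℤ × ℤ} (hq₃ : q₃ ∈ cols) (h0 : q₃ ≠ (0, 0)) (h1 : q₃ ≠ q₁) (h2 : q₃ ≠ q₂)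
    {d₁ d₂ d₃ : ℤ} (hd₁ : d₁ = 1 ∨ d₁ = -1) (hd₂ : d₂ = 1 ∨ d₂ = -1) (hd₃ : d₃ = 1 ∨ d₃ = -1)
    {β₁ β₂ β₃ : ℕ} (hb₁ : β₁ < 3) (hb₂ : β₂ < 3) (hb₃ : β₃ < 3) (hfilt : filtOf q₁ q₂ q₃ d₁ d₂ d₃ β₁ β₂ β₃ = true)
    {τ12 τ13 τ23 : ℤ} (hτ12 : τ12 ∈ TAUS) (hτ13 : τ13 ∈ TAUS) (hτ23 : τ23 ∈ TAUS)
    (r12 : d₁ = d₂ → pairRuleB β₁ β₂ τ12 d₁ (q₁ == q₂) = true) (r13 : d₁ = d₃ → pairRuleB β₁ β₃ τ13 d₁ (q₁ == q₃) = true)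
    (r23 : d₂ = d₃ → pairRuleB β₂ β₃ τ23 d₂ (q₂ == q₃) = true) (rtri : d₁ = d₂ → d₁ = d₃ → maybeB τ12 τ13 τ23 = true) :
    ∃ e : Entry, e.baseB pcB wcB q₁ q₂ q₃ d₁ d₂ d₃ 3 = true ∧
      accB e.l₁ q₁ d₁ β₁ (badB d₁) = true ∧ accB e.l₂ q₂ d₂ β₂ (badB d₂) = true ∧ accB e.l₃ q₃ d₃ β₃ (badB d₃) = true ∧
      (d₁ = d₂ → pairOKB e.l₁ e.l₂ q₁ q₂ e.F1 e.F2 d₁ τ12 = true) ∧ (d₁ = d₃ → pairOKB e.l₁ e.l₃ q₁ q₃ e.F1 e.F3 d₁ τ13 = true) ∧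
      (d₂ = d₃ → pairOKB e.l₂ e.l₃ q₂ q₃ e.F2 e.F3 d₂ τ23 = true) := by
  obtain ⟨i₃, hi₃, hget⟩ := exists_index_of_mem hq₃
  obtain ⟨hdirs, hlt⟩ := dirsOf_idirOf hd₁ hd₂ hd₃
  unfold tab3OK at h
  have hrow := all_range_get h hi₃
  simp only [hget] at hrow
  rw [Bool.or_eq_true, Bool.or_eq_true, Bool.or_eq_true, beq_iff_eq, beq_iff_eq, beq_iff_eq] at hrow
  rcases hrow with ((e | e) | e) | hrow
  · exact absurd e h0
  · exact absurd e h1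
  · exact absurd e h2
  have hk := all_range_get hrow hlt
  simp only [hdirs] at hk
  exact keyCoverB_sound hk hd₁ hd₂ hd₃ hb₁ hb₂ hb₃ hfilt hτ12 hτ13 hτ23 r12 r13 r23 rtri

end Slab111

end Summit.CriticalPhenomena.PercolationContinuityZ3.Theorems.Transplant
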